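import Summits.BirchSwinnertonDyer.BirchSwinnertonDyer.Theorems.PrintCf2SplitBadTwoNormAtVbarReduction
import HarnessLib

/-!
# Crux `PrintCf2.SplitBadTwoRankOneOfFacts` (stmt-BirchSwinnertonDyer-20368), skeleton v13.5, (REG₂) `stub_xRegular_two` FACT-FREE road, R2 brick
# **B5-T, COHOMOLOGICAL HALF: THE TWISTED KUMMER READING** — for SIGN-TWISTED coefficients (`ρ σ m₀ = ε(σ) • m₀`, `ε : Γ_K →* ℤˣ`) the
# corestricted dual-Shapiro class of a layer class `[φ] ∈ H¹(U, M′)`, probed by the RANK-ONE TWIST `ℤ/n(ε)`, is read on `ker ε` as the Kummer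
# cocycle `g ↦ g(ζ)/ζ` of `ζ = ∏_y s_y β` — the inputs `ρ`, `φY`, `hread` of -w3 g14's LOCAL HALF `…NormAtVbarTwistedLocal` (FILE 5)

Cell `bsd-print-cf2`, EXTRA WIDTH seat `bsd-line-cf2-p1-w4` g14 (prover-bsd-line-cf2-p1-w4-g14-0); `--supports stmt-BirchSwinnertonDyer-20368`
(helper, Theses-free). HONEST FRAMING: nothing here closes the crux or a registered stub; BSD is not proved by any of this; no summit
statement is proved by this seat. No definition, no named fact, no `sorry`. UNCONDITIONAL. Sequel of -w3 g14's FILE 1 `…NormAtVbarReduction`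
(p706643), whose §2/§4 are the case `ε = 1`.

WHY (STATUS 2026-08-29T07:53:45Z–08:09:58Z, «B5-T» and its split). The twisted class-level (PRO-NULL)_U (p705557) and -w8 g5's B3d′
`exists_level_levelSurj_of_classProNull_twisted` leave ONE displayed `v̄`-input `hB5`: at the places `w′ ∣ v̄` of `F′ = F·K_ε` that are SPLIT over
`F` (`ε = 1` on `U ∩ D_𝔓`) one needs `p^M ∣ ord_{w′}(b′)`. FILE 1's norm trick cannot see it (its probe `ℤ/n → Maps(Γ_K ⧸ U, M)` needs a
`Γ_K`-FIXED `m₀`; for `M = ℤ/n(ε)` there is none, and `N_{F′/K}` reads `ord_{w″₁} + ord_{w″₂} ≡ 0`, automatic). THE TWISTED PROBE: the constants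
`k ↦ (y ↦ k • m₀)` ARE equivariant from the rank-one twist `ρ₁ = ℤ/n(ε)` (both sides carry the sign), and with coset representatives `s_y`
chosen IN `ker ε` (possible iff `Γ_K = U · ker ε`) the fibre sum of the Shapiro cocycle is again a transfer ON `ker ε`:
* §1 **`exists_signTwistZMod`** — the rank-one twist `ρ₁ : DiscreteGaloisModule K (ZMod n)`, `ρ₁ σ k = ε(σ) • k` (`ker ε` open);
* §2 **`exists_constIntertwining_twisted`** — `c : ρ₁ →ⁱL Maps(Γ_K ⧸ U, M)`, `c 1 = const_{m₀}`, for `ρ σ m₀ = ε(σ) • m₀`, `n • m₀ = 0`;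
* §3 `exists_reps_one_sign` — representatives `s` of `Γ_K ⧸ U` with `s(1) = 1` and `ε ∘ s = 1`, from `∀ g, ∃ u ∈ U, ε(g u) = 1`;
  `sign_schreierElt` — then `ε(s_{gy}⁻¹ g s_y) = ε(g)`;
* §4 **`exists_cocycle_twistedKummerReading`** — THE READING: an explicit cocycle `φY` of `Y := H¹(c^D) H¹(Ψ) Sh[φ] ∈ H¹(K, ρ₁^D)` with
  **`∀ g, ε g = 1 → muVal ((φY g) 1) = g • ζ / ζ`, `ζ := ∏_y s_y • β`**, whenever `B(m₀, φ u) = uβ/β` for the `u ∈ U` with `ε u = 1` (the twisted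
  Kummer relation on `U′ = U ∩ ker ε`, -w3 g13 / -w8 g5 B3e′) — on cocycles `Σ_y B(m₀, s_y • φ(s_y⁻¹ g s_{g⁻¹y})) = ∏_y g s_{g⁻¹y}β / s_y β`;
* §5 `coe_pow_prod_smul` / `smul_prod_smul_eq_of_sign_eq_one` — `ζⁿ = ∏_y s_y • b′` and this element is FIXED BY `ker ε` (so by `D_v̄` in case (B1),
  `ε|_{D_v̄} = 1`, giving FILE 5's `zv ∈ K_v̄`); `coe_prod_absRestrictNormalHom_smul` — it is the element `∏_y (s_y|_{F′}) b′` of `F′`.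
So FILE 5's hypotheses read: `ρ := ρ₁` (`hloc` ⟸ `ε ∘ res_v̄ = 1`), `hY` ⟸ FILE 1 §1 on clause (iii) (`localMap_tateDualComap_mem_dualLocalCondition_unramified`
+ `localization_map_one_eq`), `hread` ⟸ §4 on `D_v̄ ⊆ ker ε`. presearch: «corestriction of Kummer classes twisted by a quadratic character»,
«Shapiro lemma transfer cocycle sign character» → NSW (1.5.3)(iv), (1.6.4); Greenberg LNM 1716 §4 p. 107 (twisting by characters of the
layer group); folklore plumbing, no new fact. beyond-print theorem: no.

References: [NeukirchSchmidtWingberg2008] I §5 Prop. (1.5.3)(iv), I §6 Prop. (1.6.4); [SerreLocalFields1979] VII §6–§7, X §3 b); [GreenbergLNM1716] §4 p. 107;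
[MilneADT2006] Ch. I §0, §2.
-/

noncomputable section

open scoped Classical ContRepresentation

set_option linter.dupNamespace false
set_option autoImplicit false

open CategoryTheory NumberField IsDedekindDomain Field
open Literature.NumberTheory.EllipticCurves Literature.NumberTheory.EllipticCurves.GreenbergSelmer
open Literature.NumberTheory.EllipticCurves.GreenbergVatsal2000
open Literature.NumberTheory.GaloisRepresentations Literature.NumberTheory.GaloisRepresentations.LocalWeilDatum
open Literature.NumberTheory.GaloisRepresentations.DiscreteGaloisModule (SelmerStructure mu MuCarrier TateDual tateDual
  coindTateDualMor coindTateDualHom unramifiedSubgroup localMap)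
open Literature.NumberTheory.GaloisCohomology
open Summit.BirchSwinnertonDyer.Rank1Residual.X11b.LocBridge
open Summit.BirchSwinnertonDyer.Rank1Residual.GaloisImage.Transport (tateDualComap tateDualComap_apply_apply)
open Summit.BirchSwinnertonDyer.Rank1Residual.GaloisImage.CoreRankZero (localization_map_one_eq)

namespace Summit.BirchSwinnertonDyer.BirchSwinnertonDyer.Theorems.PrintCf2.NormAtVbar

/-! ## §1. The rank-one twist `ℤ/n(ε)` as a discrete Galois module -/

section Twist

variable {K : Type} [Field K] {n : ℕ} (ε : absoluteGaloisGroup K →* ℤˣ)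

/-- **The rank-one twist `ρ₁ = ℤ/n(ε)`**: for a sign character `ε : Γ_K →* ℤˣ` with open kernel there is a discrete Galois module structure on
`ℤ/n` with `ρ₁ σ k = ε(σ) • k` (stabilisers contain the open subgroup `ker ε`). [cite: GreenbergLNM1716, §4 p. 107] -/
theorem exists_signTwistZMod (hε : IsOpen ((ε.ker : Subgroup (absoluteGaloisGroup K)) : Set (absoluteGaloisGroup K))) :
    ∃ ρ₁ : DiscreteGaloisModule K (ZMod n), ∀ (σ : absoluteGaloisGroup K) (k : ZMod n), ρ₁ σ k = ((ε σ : ℤˣ) : ℤ) • k := by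
  letI inst : DistribMulAction (absoluteGaloisGroup K) (ZMod n) := DistribMulAction.compHom (ZMod n) ε
  have hsmul : ∀ (σ : absoluteGaloisGroup K) (k : ZMod n), σ • k = ((ε σ : ℤˣ) : ℤ) • k := fun σ k ↦ Units.smul_def (ε σ) k
  have hstab : ∀ k : ZMod n, IsOpen {σ : absoluteGaloisGroup K | σ • k = k} := by
    intro k
    rw [isOpen_iff_mem_nhds]
    intro σ₀ hσ₀
    have hsub : (fun h ↦ σ₀ * h) '' ((ε.ker : Subgroup (absoluteGaloisGroup K)) : Set (absoluteGaloisGroup K)) ⊆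
        {σ : absoluteGaloisGroup K | σ • k = k} := by
      rintro _ ⟨h, hh, rfl⟩
      have hh' : ε h = 1 := (MonoidHom.mem_ker).mp hh
      change (σ₀ * h) • k = k
      rw [hsmul, map_mul, hh', mul_one, ← hsmul]
      exact hσ₀
    refine Filter.mem_of_superset ?_ hsub
    have hopen : IsOpen ((fun h ↦ σ₀ * h) '' ((ε.ker : Subgroup (absoluteGaloisGroup K)) : Set (absoluteGaloisGroup K))) :=
      (Homeomorph.mulLeft σ₀).isOpenMap _ hε
    exact hopen.mem_nhds ⟨1, ε.ker.one_mem, mul_one σ₀⟩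
  exact ⟨ofSMul (ZMod n) hstab, fun σ k ↦ by rw [ofSMul_apply_apply, hsmul]⟩

end Twist

/-! ## §2. The twisted constants `ℤ/n(ε) → Maps(Γ_K ⧸ U, M)`, `k ↦ (y ↦ k • m₀)` -/

section Constants

variable {K : Type} [Field K] {M : Type} [AddCommGroup M] [TopologicalSpace M] [DiscreteTopology M]
  (ρ : DiscreteGaloisModule K M) (U : Subgroup (absoluteGaloisGroup K)) [Fintype (absoluteGaloisGroup K ⧸ U)]
  (hU : IsOpen (U : Set (absoluteGaloisGroup K))) {n : ℕ} (ε : absoluteGaloisGroup K →* ℤˣ)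

/-- **The constant maps `ℤ/n(ε) → Maps(Γ_K ⧸ U, M)`, `k ↦ (y ↦ k • m₀)`**, for an `ε`-EIGENVECTOR `m₀ ∈ M` (`ρ σ m₀ = ε(σ) • m₀`, `n • m₀ = 0`),
form a continuous `Γ_K`-intertwining map from the rank-one twist `ρ₁ = ℤ/n(ε)`: source and target carry the same sign
(`(g ⋆ const_{zm₀})(y) = ρ g (z m₀) = z ε(g) m₀ = const_{(ε(g) z) m₀}(y)`). The case `ε = 1` is FILE 1's `exists_constIntertwining`.
[cite: NeukirchSchmidtWingberg2008, I §6] [cite: GreenbergLNM1716, §4 p. 107] -/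
theorem exists_constIntertwining_twisted (ρ₁ : DiscreteGaloisModule K (ZMod n))
    (hρ₁ : ∀ (σ : absoluteGaloisGroup K) (k : ZMod n), ρ₁ σ k = ((ε σ : ℤˣ) : ℤ) • k)
    (m₀ : M) (hm₀ : ∀ σ : absoluteGaloisGroup K, ρ σ m₀ = ((ε σ : ℤˣ) : ℤ) • m₀) (hn : n • m₀ = 0) :
    ∃ c : ρ₁.toContRepresentation →ⁱL (ρ.coind U hU).toContRepresentation, ∀ y : absoluteGaloisGroup K ⧸ U, c 1 y = m₀ := by
  let f₀ : { f : ℤ →+ M // f n = 0 } := ⟨zmultiplesHom M m₀, by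
    change (n : ℤ) • m₀ = 0
    rw [natCast_zsmul, hn]⟩
  let f : ZMod n →+ M := ZMod.lift n f₀
  let cf : ZMod n →+ (absoluteGaloisGroup K ⧸ U → M) :=
    { toFun := fun k _ ↦ f k
      map_zero' := funext fun _ ↦ f.map_zero
      map_add' := fun a b ↦ funext fun _ ↦ f.map_add a b }
  refine ⟨{ toContinuousLinearMap := ⟨cf.toIntLinearMap, continuous_of_discreteTopology⟩
            isIntertwining' := fun σ ↦ ContinuousLinearMap.ext fun k ↦ funext fun y ↦ ?_ }, fun y ↦ ?_⟩
  · change f (ρ₁ σ k) = (ρ.coind U hU) σ (fun _ ↦ f k) y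
    rw [hρ₁, DiscreteGaloisModule.coind_apply_apply, map_zsmul]
    -- `f k` is a multiple of `m₀`, an `ε`-eigenvector
    obtain ⟨z, rfl⟩ := ZMod.intCast_surjective k
    rw [ZMod.lift_coe]
    change ((ε σ : ℤˣ) : ℤ) • z • m₀ = ρ σ (z • m₀)
    rw [map_zsmul, hm₀, smul_comm]
  · change f 1 = m₀
    rw [show (1 : ZMod n) = ((1 : ℤ) : ZMod n) from Int.cast_one.symm, ZMod.lift_coe]
    exact one_zsmul m₀

end Constants

/-! ## §3. Representatives of `Γ_K ⧸ U` inside `ker ε` -/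

section Reps

variable {G : Type*} [Group G] (N : Subgroup G) (ε : G →* ℤˣ)

/-- **Representatives in `ker ε`.** If every coset `gN` meets `ker ε` (`∀ g, ∃ u ∈ N, ε(g u) = 1`; e.g. `ε(N) ∋ −1`, or `ε = 1`), there is a
system of representatives `s` of `G ⧸ N` with `s(1·N) = 1` and `ε ∘ s = 1`. [folklore] -/
theorem exists_reps_one_sign (h : ∀ g : G, ∃ u ∈ N, ε (g * u) = 1) :
    ∃ s : G ⧸ N → G, (∀ x : G ⧸ N, (s x : G ⧸ N) = x) ∧ s ((1 : G) : G ⧸ N) = 1 ∧ ∀ x, ε (s x) = 1 := by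
  classical
  choose u hu hεu using h
  refine ⟨fun x ↦ if x = ((1 : G) : G ⧸ N) then 1 else x.out * u x.out, fun x ↦ ?_, by simp, fun x ↦ ?_⟩
  · by_cases hx : x = ((1 : G) : G ⧸ N)
    · subst hx
      simp only [if_true]
    · simp only [if_neg hx]
      rw [QuotientGroup.mk_mul_of_mem _ (hu _), QuotientGroup.out_eq']
  · by_cases hx : x = ((1 : G) : G ⧸ N)
    · simp only [if_pos hx, map_one]
    · simp only [if_neg hx]
      exact hεu _

variable {N ε} in
/-- For representatives in `ker ε`, the Schreier element `s_{g x}⁻¹ g s_x ∈ N` has sign `ε(g)`. [folklore] -/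
theorem sign_schreierElt {s : G ⧸ N → G} (hs : ∀ x : G ⧸ N, (s x : G ⧸ N) = x) (hsε : ∀ x, ε (s x) = 1) (g : G) (x : G ⧸ N) :
    ε (schreierElt N hs g x : G) = ε g := by
  rw [schreierElt_coe, map_mul, map_mul, map_inv, hsε, hsε, inv_one, one_mul, mul_one]

end Reps

/-! ## §4. The twisted Kummer reading of the corestricted dual-Shapiro class -/

section Kummer

variable {K : Type} [Field K] [NumberField K]
  {M : Type} [AddCommGroup M] [TopologicalSpace M] [DiscreteTopology M] [Finite M] (ρ : DiscreteGaloisModule K M)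
  {M' : Type} [AddCommGroup M'] [DistribMulAction (absoluteGaloisGroup K) M'] [TopologicalSpace M'] [DiscreteTopology M']
  (hM' : ∀ m : M', IsOpen {σ : absoluteGaloisGroup K | σ • m = m})
  {n : ℕ} [NeZero n] (B : M →+ M' →+ MuCarrier K n)
  (hB : ∀ (σ : absoluteGaloisGroup K) (m : M) (m' : M'), B (ρ σ m) (ofSMul M' hM' σ m') = mu K n σ (B m m'))
  (F : IntermediateField K (AlgebraicClosure K)) (hU : IsOpen (galFixing K F : Set (absoluteGaloisGroup K)))
  [Fintype (absoluteGaloisGroup K ⧸ galFixing K F)]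
  {s : absoluteGaloisGroup K ⧸ galFixing K F → absoluteGaloisGroup K}
  (hs : ∀ y, (s y : absoluteGaloisGroup K ⧸ galFixing K F) = y) (hs1 : s ((1 : absoluteGaloisGroup K) : absoluteGaloisGroup K ⧸ galFixing K F) = 1)
  (ε : absoluteGaloisGroup K →* ℤˣ) (hsε : ∀ y, ε (s y) = 1)
  {m₀ : M} (hm₀ : ∀ σ : absoluteGaloisGroup K, ρ σ m₀ = ((ε σ : ℤˣ) : ℤ) • m₀)

omit [NumberField K] [Finite M] [NeZero n] in
include hB hm₀ in
/-- `B(m₀, ·)` intertwines `σ` whenever `ε(σ) = 1` (`m₀` is an `ε`-eigenvector). [cite: MilneADT2006, Ch. I §0] -/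
theorem muVal_B_smul_of_sign_eq_one {σ : absoluteGaloisGroup K} (hσ : ε σ = 1) (m' : M') :
    muVal K n (B m₀ (σ • m')) = σ • muVal K n (B m₀ m') := by
  have h := hB σ m₀ m'
  rw [hm₀, hσ, Units.val_one, one_zsmul, ofSMul_apply_apply] at h
  rw [h, muVal_apply]

omit [NumberField K] in
include hs hsε hm₀ in
/-- **THE TWISTED KUMMER READING.** Setting: `ρ` a finite discrete `Γ_K`-module with an `ε`-eigenvector `m₀` (`ρ σ m₀ = ε(σ) • m₀`), `M′` a
discrete `Γ_K`-module with an equivariant pairing `B : M × M′ → μₙ`, `U = Gal(K̄/F)` (`F/K` finite Galois) with representatives `s` CHOSEN IN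
`ker ε` (`s 1 = 1`), `ρ₁ = ℤ/n(ε)` with the twisted constants `c` at `m₀` (§2). For a layer cocycle `φ : U → M′` whose image under `B(m₀, ·)` is
the Kummer cocycle of `β` ON THE ELEMENTS OF SIGN `1` (`B(m₀, φ u) = uβ/β` for `u ∈ U`, `ε u = 1` — the twisted Kummer relation on
`U′ = U ∩ ker ε`), the class `Y := H¹(c^D) H¹(Ψ) Sh[φ] ∈ H¹(K, ρ₁^D)` has an explicit cocycle `φY` with
**`muVal ((φY g) 1) = g(ζ)/ζ` for every `g ∈ ker ε`, `ζ := ∏_y s_y • β`** (fibre sum = transfer on `ker ε`: the Schreier elements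
`s_y⁻¹ g s_{g⁻¹y}` have sign `ε(g) = 1`). The case `ε = 1` is FILE 1's `map_eval_tateDualComap_dualShapiro_eq_kummerMap_norm`.
[cite: NeukirchSchmidtWingberg2008, I §5 Prop. (1.5.3)(iv), I §6 Prop. (1.6.4)] [cite: SerreLocalFields1979, VII §6–§7, X §3 b)] -/
theorem exists_cocycle_twistedKummerReading (ρ₁ : DiscreteGaloisModule K (ZMod n))
    (c : ρ₁.toContRepresentation →ⁱL (ρ.coind (galFixing K F) hU).toContRepresentation) (hc : ∀ y, c 1 y = m₀)
    (φ : contOneCocycles (discreteTopRep (galFixing K F) M'))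
    (β : (AlgebraicClosure K)ˣ)
    (hβ : ∀ u : galFixing K F, ε u = 1 → muVal K n (B m₀ (φ.1 u)) = (u : absoluteGaloisGroup K) • β / β) :
    ∃ φY : contOneCocycles (ρ₁.tateDual n).toTopRep,
      oneCocycleClass _ φY =
        galoisCohomology.map (tateDualComap c) 1
          (cohomologyMap (coindTateDualMor ρ (ofSMul M' hM') (galFixing K F) B hU hB) 1
            (shapiroLift (ofSMul M' hM').toTopRep (galFixing K F) hU hs hs1 (oneCocycleClass _ φ))) ∧
      ∀ g : absoluteGaloisGroup K, ε g = 1 →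
        muVal K n ((φY.1 g) 1) = g • (∏ y : absoluteGaloisGroup K ⧸ galFixing K F, (s y) • β) /
          ∏ y : absoluteGaloisGroup K ⧸ galFixing K F, (s y) • β := by
  refine ⟨contOneCocycles.pullback (ContinuousMonoidHom.id (absoluteGaloisGroup K))
      (X := ((ρ.coind (galFixing K F) hU).tateDual n).toTopRep) (Y := (ρ₁.tateDual n).toTopRep)
      (TopRep.ofHom ⟨(tateDualComap c).toContinuousLinearMap, (tateDualComap c).isIntertwining'⟩)
      (contOneCocycles.pullback (ContinuousMonoidHom.id (absoluteGaloisGroup K))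
        (resIdHom (coindTateDualMor ρ (ofSMul M' hM') (galFixing K F) B hU hB))
        (shapiroCocycle (ofSMul M' hM').toTopRep (galFixing K F) hU hs φ)), ?_, fun g hg ↦ ?_⟩
  · rw [shapiroLift_oneCocycleClass, cohomologyMap_oneCocycleClass, galoisCohomology.map_one_oneCocycleClass]
  · rw [contOneCocycles.pullback_apply, contOneCocycles.pullback_apply]
    change muVal K n (tateDualComap c (coindTateDualHom (galFixing K F) B
      ((shapiroCocycle (ofSMul M' hM').toTopRep (galFixing K F) hU hs φ).1 g)) 1) = _
    rw [tateDualComap_apply_apply, DiscreteGaloisModule.coindTateDualHom_apply_apply, muVal_sum]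
    -- factorwise: `B(m₀, s_y • φ(sch)) ↦ g(s_{g⁻¹y} β) / s_y β`
    have key : ∀ y : absoluteGaloisGroup K ⧸ galFixing K F,
        muVal K n (B (c 1 y) ((shapiroCocycle (ofSMul M' hM').toTopRep (galFixing K F) hU hs φ).1 g y)) =
          g • ((s (g⁻¹ • y)) • β) / ((s y) • β) := by
      intro y
      rw [hc, shapiroCocycle_apply]
      change muVal K n (B m₀ ((s y) • φ.1 (schreierElt (galFixing K F) hs g (g⁻¹ • y)))) = _
      have hsch : ε (schreierElt (galFixing K F) hs g (g⁻¹ • y) : absoluteGaloisGroup K) = 1 := by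
        rw [sign_schreierElt hs hsε, hg]
      rw [muVal_B_smul_of_sign_eq_one ρ hM' B hB ε hm₀ (hsε y), hβ _ hsch, schreierElt_coe, smul_inv_smul, smul_div', ← mul_smul,
        ← mul_smul, mul_assoc (s y)⁻¹, mul_inv_cancel_left]
    rw [Finset.prod_congr rfl fun y _ ↦ key y, Finset.prod_div_distrib, ← Finset.smul_prod']
    -- reindex `y ↦ g⁻¹ • y`
    change g • (∏ x, s (g⁻¹ • x) • β) / (∏ y, s y • β) = g • (∏ y, s y • β) / (∏ y, s y • β)
    rw [Fintype.prod_equiv (MulAction.toPerm g⁻¹) (fun x ↦ s (g⁻¹ • x) • β) (fun y ↦ s y • β) (fun _ ↦ rfl)]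

/-! ## §5. `ζⁿ = ∏_y s_y • b′`, fixed by `ker ε`, an element of `F′` -/

omit [NumberField K] [NeZero n] [Fintype (absoluteGaloisGroup K ⧸ galFixing K F)] in
/-- **`(∏_y s_y • β)ⁿ = ∏_y s_y • b′`** for `βⁿ = b′`. [folklore] -/
theorem coe_pow_prod_smul [Fintype (absoluteGaloisGroup K ⧸ galFixing K F)] (β : (AlgebraicClosure K)ˣ) (b' : AlgebraicClosure K)
    (hb : b' = ((β ^ n : (AlgebraicClosure K)ˣ) : AlgebraicClosure K)) :
    (((∏ y : absoluteGaloisGroup K ⧸ galFixing K F, (s y) • β) ^ n : (AlgebraicClosure K)ˣ) : AlgebraicClosure K) =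
      ∏ y : absoluteGaloisGroup K ⧸ galFixing K F, (s y) • b' := by
  rw [Units.val_pow_eq_pow_val, Units.coe_prod, ← Finset.prod_pow, hb]
  refine Finset.prod_congr rfl fun y _ ↦ ?_
  rw [Units.coe_smul, ← smul_pow', ← Units.val_pow_eq_pow_val]

omit [NumberField K] in
include hs hsε in
/-- **`∏_y s_y • b′` is FIXED BY `ker ε`** when `b′` is fixed by the `u ∈ U` of sign `1` (e.g. `b′ ∈ F′ = K̄^{U ∩ ker ε}`): for `g ∈ ker ε`,
`g s_y = s_{gy} u_y` with `u_y ∈ U`, `ε(u_y) = 1`, and `y ↦ gy` permutes the cosets. In case (B1) (`ε|_{D_v̄} = 1`) this makes `ζⁿ` a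
`D_v̄`-invariant, i.e. an element of `K_v̄` under the embedding `K̄ → K̄_v̄` — the `zv` of FILE 5. [cite: NeukirchANT1999, Ch. IV §1] -/
theorem smul_prod_smul_eq_of_sign_eq_one (b' : AlgebraicClosure K)
    (hb' : ∀ u : galFixing K F, ε u = 1 → (u : absoluteGaloisGroup K) • b' = b') {g : absoluteGaloisGroup K} (hg : ε g = 1) :
    g • ∏ y : absoluteGaloisGroup K ⧸ galFixing K F, (s y) • b' = ∏ y : absoluteGaloisGroup K ⧸ galFixing K F, (s y) • b' := by
  rw [Finset.smul_prod']
  -- `g • s_y • b′ = s_{g y} • b′`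
  have key : ∀ y : absoluteGaloisGroup K ⧸ galFixing K F, g • (s y) • b' = (s (g • y)) • b' := by
    intro y
    have hcoset : ((s (g • y) : absoluteGaloisGroup K) : absoluteGaloisGroup K ⧸ galFixing K F) =
        ((g * s y : absoluteGaloisGroup K) : absoluteGaloisGroup K ⧸ galFixing K F) := by
      rw [hs]
      conv_lhs => rw [← hs y]
      rfl
    have hmem : (s (g • y))⁻¹ * (g * s y) ∈ galFixing K F := QuotientGroup.eq.mp hcoset
    have hεu : ε (⟨(s (g • y))⁻¹ * (g * s y), hmem⟩ : galFixing K F) = 1 := by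
      change ε ((s (g • y))⁻¹ * (g * s y)) = 1
      rw [map_mul, map_mul, map_inv, hsε, hsε, hg, inv_one, one_mul, one_mul]
    have hfix := hb' ⟨(s (g • y))⁻¹ * (g * s y), hmem⟩ hεu
    change ((s (g • y))⁻¹ * (g * s y)) • b' = b' at hfix
    calc g • (s y) • b' = (g * s y) • b' := (mul_smul _ _ _).symm
      _ = (s (g • y) * ((s (g • y))⁻¹ * (g * s y))) • b' := by rw [mul_inv_cancel_left]
      _ = (s (g • y)) • b' := by rw [mul_smul, hfix]
  rw [Finset.prod_congr rfl fun y _ ↦ key y]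
  exact Fintype.prod_equiv (MulAction.toPerm g) (fun y ↦ s (g • y) • b') (fun y ↦ s y • b') (fun _ ↦ rfl)

omit [NumberField K] [Fintype (absoluteGaloisGroup K ⧸ galFixing K F)] in
/-- **`∏_y s_y • b′` is the element `∏_y (s_y|_{F′}) b′` of `F′`** for `b′` in a finite Galois `F′ ⊆ K̄` (`σ • b′ = (σ|_{F′}) b′`,
`AlgEquiv.restrictNormal_commutes`). [cite: NeukirchANT1999, Ch. IV §1] -/
theorem coe_prod_absRestrictNormalHom_smul [Fintype (absoluteGaloisGroup K ⧸ galFixing K F)] (F' : IntermediateField K (AlgebraicClosure K))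
    [IsGalois K F'] (b' : F') :
    (((∏ y : absoluteGaloisGroup K ⧸ galFixing K F, absRestrictNormalHom F' (s y) b' : F') : F') : AlgebraicClosure K) =
      ∏ y : absoluteGaloisGroup K ⧸ galFixing K F, (s y) • (b' : AlgebraicClosure K) := by
  rw [IntermediateField.coe_prod]
  refine Finset.prod_congr rfl fun y _ ↦ ?_
  exact AlgEquiv.restrictNormal_commutes (s y) F' b'

/-! ## §6. The dual local condition of the probed class (FILE 5's `hY`) -/

/-- **Clause (iii) at `v̄` ⟹ FILE 5's `hY`.** If the localisation at `v̄` of the dual-Shapiro class `H¹(Ψ) Sh[φ]` lies in the canonical dual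
local condition of `H¹_ur(K_v̄, Maps(Γ_K ⧸ U, M))` (clause (iii) of B2d, VERBATIM), then so does the localisation of ANY cocycle `φY` of the
probed class `H¹(c^D) H¹(Ψ) Sh[φ] ∈ H¹(K, ρ₁^D)` with respect to `H¹_ur(K_v̄, ρ₁)` (FILE 1 §1 `localMap_tateDualComap_mem_dualLocalCondition_unramified`
+ `localization_map_one_eq`). [cite: NeukirchSchmidtWingberg2008, I §4 (1.4.2)] [cite: Howard2004HeegnerKolyvagin, Def. 2.1.6 (arXiv:1202.6340 p. 5)] -/
theorem localization_mem_dualLocalCondition_of_dualShapiro_mem (ρ₁ : DiscreteGaloisModule K (ZMod n))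
    (c : ρ₁.toContRepresentation →ⁱL (ρ.coind (galFixing K F) hU).toContRepresentation) (vbar : HeightOneSpectrum (𝓞 K))
    (φ : contOneCocycles (discreteTopRep (galFixing K F) M'))
    (hvbar : galoisCohomology.localization ((ρ.coind (galFixing K F) hU).tateDual n) (Sum.inr vbar) 1
        (cohomologyMap (coindTateDualMor ρ (ofSMul M' hM') (galFixing K F) B hU hB) 1
          (shapiroLift (ofSMul M' hM').toTopRep (galFixing K F) hU hs hs1 (oneCocycleClass _ φ))) ∈
      (LocalInvariants.canonical K n).dualLocalCondition (ρ.coind (galFixing K F) hU) (Sum.inr vbar)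
        (unramifiedSubgroup (GaloisRep.toLocal vbar (ρ.coind (galFixing K F) hU)) 1))
    (φY : contOneCocycles (ρ₁.tateDual n).toTopRep)
    (hφY : oneCocycleClass _ φY =
        galoisCohomology.map (tateDualComap c) 1
          (cohomologyMap (coindTateDualMor ρ (ofSMul M' hM') (galFixing K F) B hU hB) 1
            (shapiroLift (ofSMul M' hM').toTopRep (galFixing K F) hU hs hs1 (oneCocycleClass _ φ)))) :
    galoisCohomology.localization (ρ₁.tateDual n) (Sum.inr vbar) 1 (oneCocycleClass _ φY) ∈
      (LocalInvariants.canonical K n).dualLocalCondition ρ₁ (Sum.inr vbar) (unramifiedSubgroup (GaloisRep.toLocal vbar ρ₁) 1) := by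
  rw [hφY, localization_map_one_eq]
  exact localMap_tateDualComap_mem_dualLocalCondition_unramified c (LocalInvariants.canonical K n) vbar hvbar


end Kummer

end Summit.BirchSwinnertonDyer.BirchSwinnertonDyer.Theorems.PrintCf2.NormAtVbar

end
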